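import Mathlib
import Summits.CriticalPhenomena.CardyFormulaZ2.Theorems.CardySelfRefinementGradientComparabilityStubSlopeBoundsFiniteEnergy
import HarnessLib

/-!
# Slope bounds, Stage B ingredient: the cost of a local modification under `M_k(ρ,c)`

Crux `stmt-CriticalPhenomena-10269`
(`Summit.CriticalPhenomena.CardyFormulaZ2.Theses.CardySelfRefinement.GradientComparability`),
line `monotone-product-coordinates`, helper file of the stub `stub_slopeBounds`.  Vocabulary
(`M edgeOf`) from `CardySelfRefinementDefs`; single-edge finite energy of `M_k` from
`…StubSlopeBoundsFiniteEnergy`.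

## Mathematics

Iterating the single-edge finite energy of `M_k(ρ,c)` (`M_real_insert_le_and_sdiff_le`, factor
`K = 2^k/(1-ρ) + 1/c + 1/(1-c)` per edge) over a finite set `N` of edges of `ℤ²`: prescribing the
states of the edges of `N` costs `K^{|N|}` (`M_real_sdiff_union_le`, induction on `N`), and the
event "some modification of `ω` on `N` lies in `E`" is the union over the `2^{|N|}` patterns, so

`M{ω | ∃ Rm S ⊆ N, (ω ∖ Rm) ∪ S ∈ E} ≤ (2K)^{|N|} · M(E)`

(`M_real_exists_modification_le`, registered sub-goal) — the `M_k` replacement, uniform on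
`ρ ≤ 1-δ`, `c ∈ [c_lo, c_hi]`, of the Bernoulli lemma `real_setOf_exists_modification_le` used by
`stub_nonAxialShare_bulk`.  (Grimmett 1999 §2.4 (2.32); Newman–Schulman 1981, finite energy.)
-/

noncomputable section

namespace Summit.CriticalPhenomena.CardyFormulaZ2.Theorems.CardySelfRefinement

open scoped Topology
open Filter Set MeasureTheory
open Literature.Probability.LatticeModels Literature.Probability.Percolation
open Literature.Probability.Percolation.QuadCrossing
open Summit.CriticalPhenomena.CardyFormulaZ2.Theses.CardySelfRefinement

/-- **Prescribing the states of finitely many edges.** For a finite set `N` of edges of `ℤ²`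
(each of the form `edgeOf (v, d)`), a pattern `P` and a measurable `E`:
`M{ω | (ω ∖ N) ∪ (P ∩ N) ∈ E} ≤ K^{|N|} · M(E)`, `K = 2^k/(1-ρ) + 1/c + 1/(1-c)`. -/
theorem M_real_sdiff_union_le {k : ℕ} (hk : 0 < k) {ρ : ℝ} (hρ : ρ ∈ Set.Ico (0 : ℝ) 1) {c : ℝ}
    (hc : c ∈ Set.Ioo (0 : ℝ) 1) (N : Finset (Sym2 (Site 2)))
    (hN : ∀ e ∈ N, ∃ (v : Site 2) (d : Fin 2), e = edgeOf (v, d)) (P : Set (Sym2 (Site 2)))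
    {E : Set (BondConfig (Site 2))} (hE : MeasurableSet E) :
    (M k ρ c).real {ω | ω \ ↑N ∪ (P ∩ ↑N) ∈ E} ≤
      (2 ^ k / (1 - ρ) + 1 / c + 1 / (1 - c)) ^ N.card * (M k ρ c).real E := by
  classical
  set K : ℝ := 2 ^ k / (1 - ρ) + 1 / c + 1 / (1 - c) with hK
  have hK0 : 0 ≤ K := by
    have hA : 0 ≤ (2 : ℝ) ^ k / (1 - ρ) := div_nonneg (by positivity) (by linarith [hρ.2])
    have hB : 0 ≤ 1 / c := div_nonneg zero_le_one hc.1.le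
    have hC : 0 ≤ 1 / (1 - c) := div_nonneg zero_le_one (by linarith [hc.2])
    simp only [hK]
    positivity
  induction N using Finset.induction_on generalizing E with
  | empty =>
    simp only [Finset.coe_empty, Set.sdiff_empty, Set.inter_empty, Set.union_empty, Finset.card_empty,
      pow_zero, one_mul]
    exact le_of_eq rfl
  | insert e N' he ih =>
    have hN' : ∀ x ∈ N', ∃ (v : Site 2) (d : Fin 2), x = edgeOf (v, d) := fun x hx =>
      hN x (Finset.mem_insert_of_mem hx)
    obtain ⟨v, d, rfl⟩ := hN _ (Finset.mem_insert_self _ _)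
    have htol := M_real_insert_le_and_sdiff_le k hk ρ hρ c hc v d E hE
    rw [Finset.card_insert_of_notMem he, pow_succ, mul_assoc]
    by_cases heP : edgeOf (v, d) ∈ P
    · -- the edge is prescribed open
      have hset : {ω : BondConfig (Site 2) | ω \ ↑(insert (edgeOf (v, d)) N') ∪ (P ∩ ↑(insert (edgeOf (v, d)) N')) ∈ E} =
          {ω | ω \ ↑N' ∪ (P ∩ ↑N') ∈ {ω' | insert (edgeOf (v, d)) ω' ∈ E}} := by
        ext ω
        simp only [Set.mem_setOf_eq]
        have h : ω \ ↑(insert (edgeOf (v, d)) N') ∪ (P ∩ ↑(insert (edgeOf (v, d)) N')) =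
            insert (edgeOf (v, d)) (ω \ ↑N' ∪ (P ∩ ↑N')) := by
          ext x
          simp only [Finset.coe_insert, Set.mem_union, Set.mem_sdiff, Set.mem_insert_iff,
            Set.mem_inter_iff, Finset.mem_coe, not_or]
          by_cases hx : x = edgeOf (v, d)
          · subst hx
            simp [heP]
          · simp [hx]
        rw [h]
      rw [hset]
      refine (ih hN' (measurable_insert_pt _ hE)).trans ?_
      exact mul_le_mul_of_nonneg_left htol.1 (pow_nonneg hK0 _)
    · -- the edge is prescribed closed
      have hset : {ω : BondConfig (Site 2) | ω \ ↑(insert (edgeOf (v, d)) N') ∪ (P ∩ ↑(insert (edgeOf (v, d)) N')) ∈ E} =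
          {ω | ω \ ↑N' ∪ (P ∩ ↑N') ∈ {ω' | ω' \ {edgeOf (v, d)} ∈ E}} := by
        ext ω
        simp only [Set.mem_setOf_eq]
        have h : ω \ ↑(insert (edgeOf (v, d)) N') ∪ (P ∩ ↑(insert (edgeOf (v, d)) N')) =
            (ω \ ↑N' ∪ (P ∩ ↑N')) \ {edgeOf (v, d)} := by
          ext x
          simp only [Finset.coe_insert, Set.mem_union, Set.mem_sdiff, Set.mem_insert_iff,
            Set.mem_inter_iff, Finset.mem_coe, not_or, Set.mem_singleton_iff]
          by_cases hx : x = edgeOf (v, d)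
          · subst hx
            simp [heP]
          · simp [hx]
        rw [h]
      rw [hset]
      refine (ih hN' (measurable_sdiff_pt _ hE)).trans ?_
      exact mul_le_mul_of_nonneg_left htol.2 (pow_nonneg hK0 _)

/-- **The cost of a local modification under `M_k(ρ,c)`** (registered sub-goal
`M_real_exists_modification_le` of `stub_slopeBounds`, Stage B ingredient): for `0 < k`,
`0 ≤ ρ < 1`, `0 < c < 1`, a finite set `N` of edges of `ℤ²` and a measurable `E`, the event "some
configuration obtained from `ω` by closing and opening edges of `N` lies in `E`" has probability
at most `(2K)^{|N|} · M(E)`, `K = 2^k/(1-ρ) + 1/c + 1/(1-c)`. -/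
theorem M_real_exists_modification_le :
    ∀ k : ℕ, 0 < k → ∀ ρ ∈ Set.Ico (0 : ℝ) 1, ∀ c ∈ Set.Ioo (0 : ℝ) 1, ∀ N : Finset (Sym2 (Site 2)), (∀ e ∈ N, ∃ (v : Site 2) (d : Fin 2), e = edgeOf (v, d)) → ∀ E : Set (BondConfig (Site 2)), MeasurableSet E → (M k ρ c).real {ω | ∃ Rm S : Set (Sym2 (Site 2)), Rm ∪ S ⊆ ↑N ∧ ω \ Rm ∪ S ∈ E} ≤ (2 * (2 ^ k / (1 - ρ) + 1 / c + 1 / (1 - c))) ^ N.card * (M k ρ c).real E := by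
  intro k hk ρ hρ c hc N hN E hE
  classical
  haveI := isProbabilityMeasure_M k ρ c
  set K : ℝ := 2 ^ k / (1 - ρ) + 1 / c + 1 / (1 - c) with hK
  -- cover by the patterns on `N`
  have hcov : {ω : BondConfig (Site 2) | ∃ Rm S : Set (Sym2 (Site 2)), Rm ∪ S ⊆ ↑N ∧ ω \ Rm ∪ S ∈ E} ⊆
      ⋃ P ∈ N.powerset, {ω | ω \ ↑N ∪ ((↑P : Set (Sym2 (Site 2))) ∩ ↑N) ∈ E} := by
    rintro ω ⟨Rm, S, hRS, hωE⟩
    set P : Finset (Sym2 (Site 2)) := N.filter (fun x => x ∈ ω \ Rm ∪ S) with hP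
    refine Set.mem_iUnion₂.2 ⟨P, Finset.mem_powerset.2 (Finset.filter_subset _ _), ?_⟩
    show ω \ ↑N ∪ (↑P ∩ ↑N) ∈ E
    convert hωE using 1
    ext x
    simp only [Set.mem_union, Set.mem_sdiff, hP, Finset.coe_filter, Set.mem_setOf_eq, Set.mem_inter_iff,
      Finset.mem_coe]
    constructor
    · rintro (⟨hxω, hxN⟩ | ⟨⟨-, h⟩, -⟩)
      · exact Or.inl ⟨hxω, fun h => hxN (hRS (Or.inl h))⟩
      · exact h
    · intro h
      by_cases hxN : x ∈ N
      · exact Or.inr ⟨⟨hxN, h⟩, hxN⟩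
      · rcases h with ⟨hxω, -⟩ | hxS
        · exact Or.inl ⟨hxω, hxN⟩
        · exact absurd (hRS (Or.inr hxS)) hxN
  calc (M k ρ c).real {ω | ∃ Rm S : Set (Sym2 (Site 2)), Rm ∪ S ⊆ ↑N ∧ ω \ Rm ∪ S ∈ E}
      ≤ (M k ρ c).real (⋃ P ∈ N.powerset, {ω | ω \ ↑N ∪ ((↑P : Set (Sym2 (Site 2))) ∩ ↑N) ∈ E}) :=
        measureReal_mono hcov (measure_ne_top _ _)
    _ ≤ ∑ P ∈ N.powerset, (M k ρ c).real {ω | ω \ ↑N ∪ ((↑P : Set (Sym2 (Site 2))) ∩ ↑N) ∈ E} :=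
        measureReal_biUnion_finset_le _ _
    _ ≤ ∑ P ∈ N.powerset, K ^ N.card * (M k ρ c).real E :=
        Finset.sum_le_sum fun P _ => M_real_sdiff_union_le hk hρ hc N hN _ hE
    _ = (2 * K) ^ N.card * (M k ρ c).real E := by
        rw [Finset.sum_const, Finset.card_powerset, nsmul_eq_mul, mul_pow]
        push_cast
        ring

end Summit.CriticalPhenomena.CardyFormulaZ2.Theorems.CardySelfRefinement

end
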